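import Summits.BirchSwinnertonDyer.BirchSwinnertonDyer.Theorems.ErratumRoadFiveEulerHalfGenusSharpKolyvaginAtPrime
import Summits.BirchSwinnertonDyer.BirchSwinnertonDyer.Theorems.ClassRecordThreeShimuraKolyvaginOrderBoundAtThreeSurjOrderEntry
import Summits.BirchSwinnertonDyer.BirchSwinnertonDyer.Theorems.ClassRecordThreeShimuraKolyvaginOrderBoundAtThreeSurjOrderReciprocity
import Summits.BirchSwinnertonDyer.BirchSwinnertonDyer.Theorems.SemiOrdinaryEisensteinDescentShaTwoCochainShell
import Summits.BirchSwinnertonDyer.BirchSwinnertonDyer.Theorems.SemiOrdinaryEisensteinDescentShaTwoCochainBridgeAssemblyCriterion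
import Summits.BirchSwinnertonDyer.BirchSwinnertonDyer.Theorems.SemiOrdinaryEisensteinDescentShaTwoCochainClassReadout
import Literature.NumberTheory.EllipticCurves.HeegnerPointsKolyvaginExceptionalSelmerProofs
import Literature.NumberTheory.EllipticCurves.HeegnerPointsKolyvaginPrimaryGeneratorProofs
import Literature.NumberTheory.EllipticCurves.WeilPairingProofs
import Literature.NumberTheory.EllipticCurves.ZywinaCMImageProofs
import Literature.NumberTheory.EllipticCurves.BSDRootNumberSmallConductorProofs
import Literature.NumberTheory.Automorphic.ChebotarevArtinRepHolds
import Literature.NumberTheory.GaloisCohomology.PoitouTateNumberField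
import HarnessLib

/-!
# Kolyvagin's bound REFINED BY GLOBAL DIVISIBILITY for an ABSTRACT system of Kolyvagin CLASSES attached to a non-torsion
# point `P ∈ E(K)` of finite index: `ord_p #Ш(E/K)[p^∞] + 2t ≤ 2·ord_p [E(K) : ℤP]` — all duality inputs DISCHARGED by tree
# theorems (crux stmt-BirchSwinnertonDyer-23444 `EulerHalfPOnlyMultPotMultTwinAtFive`, line `genus`, stub S4♭; helper)

Cell `bsd-stepL` (run/shared/lean/pub/bsd-stepL/), seat `bsd-stepL-genus-p2` (prover g0). Sequel of parts 1–3
(`…GenusSharpKolyvagin{Bound,Sha,AtPrime}`); sharp twin of bsd-addord's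
`AbstractKolyvaginOrder.card_sha_primaryComponent_dvd_pow_index_of_leaves`
(`AdditiveBranchIMCGordTwoRankZeroOffCaseOneAbstractKolyvaginDivisibility`, MultLower U-b), whose proof is followed token for
token: Weil pairings (`exists_weilPairing_holds`), Čebotarev (`chebotarev_artinRep_holds`), the levelwise Cassels–Tate inputs
(the Ш²-cochain bridge of `ShaTwoCochainTheta`, re-composed from its route-independent parts), `M₀ = ord_p P`
(`exists_pow_smul_eq_and_forall_ne`), the case `p ∤ P` by Gross's §10 descent (`card_selmerGroup_eq_of_localData`), the case
`p ∣ P` by part 3 (McCallum's descent REFINED by the divisibility of the top class), and `p^{M₀} ∣ [E(K) : ℤP]`.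

## What

`padicValNat_card_sha_primaryComponent_add_le_of_sharpLeaves` — for `E/ℚ` elliptic of conductor `N₀`, `K` imaginary
quadratic, `p` odd with `ρ̄_{E,p}` onto, `P` non-torsion of FINITE index, and a depth `t`: GRANTED the levelwise SHARP
CLASS-level leaves `hleaves` (at every level `p^M`: Kolyvagin classes `cl` attached to `P` with leaf (A) eigen-sign ∕ Selmer
off `m` ∕ `λ`-switch, (B), (B₂) — the hypothesis of the tree's conductor-keyed one-prime machine VERBATIM — AND (D) «every
`cl m`, `m` a square-free product of Kolyvagin primes of level `p^M`, is killed by `p^{M − t}`», i.e. global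
`p^t`-divisibility of the system): `Ш(E/K)[p^∞]` is finite and **`ord_p #Ш(E/K)[p^∞] + 2t ≤ 2·ord_p [E(K) : ℤP]`**.
(For `t = 0` this is the tree's coarse bound; (D) at `M = 1`, `m = 1` forces `t = 0` when `p ∤ P`.) This is McCallum 1991
Cor. 5.6 *"`ord_p|Ш(E/K)| = 2(M_0 − m)`"* read as the UPPER bound with `m ≥ t` (Jetchev 2008 (1), Cor. 1.5: the half that
absorbs the Tamagawa exponent), for ANY Heegner-type system of classes — in particular for one TRANSPORTED from the Heegner
points of another curve (the genus system of line `genus`), for which the printed∕named X₀(N)-keyed statement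
`McCallum1991_padicValNat_card_sha_primary_add_le_of_globalDivisibility` is not available.
-- adapted from Summits/BirchSwinnertonDyer/BirchSwinnertonDyer/Theorems/AdditiveBranchIMCGordTwoRankZeroOffCaseOneAbstractKolyvaginDivisibility.lean

## Honest framing

THEOREMS ONLY and two private lemmas (no `def`, no named fact, no `sorry`; axioms standard). CONDITIONAL only on the
displayed sharp leaves. Nothing here constructs the genus system, proves its Selmer condition at the carrier, or proves its
divisibility (the content of Jetchev's Thm. 1.4 in the genus frame): stub S4♭ and item 23444 stay OPEN; BSD is proved for no
curve. The point-level entry (classes := McCallum's cocycle of Heegner-type points) follows in the sequel `…Points`.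

References: [cite: McCallumLMS1991, §1 Theorem, Lemma 5.1, Thm. 5.4, Cor. 5.6 (p. 310)] [cite: Jetchev2008, p. 812 (1), Cor. 1.5]
[cite: GrossLMS1991, §2 Prop. 2.1, Thm. 2.2 (2), §10] [cite: MilneADT2006, Ch. I Thm. 4.10, §6 Prop. 6.9, Thm. 6.13(a)].
presearch: as in part 1; tree `lean search 'add_le_of_sharpLeaves'` → none.
-/
noncomputable section

open scoped Classical Pointwise

-- every file of `Summits/BirchSwinnertonDyer/BirchSwinnertonDyer/Theorems/` lives in this namespace
set_option linter.dupNamespace false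

namespace Summit.BirchSwinnertonDyer.BirchSwinnertonDyer.Theorems.GenusSharpKolyvagin
open WeierstrassCurve NumberField IsDedekindDomain Field Function
open Literature.NumberTheory.EllipticCurves Literature.NumberTheory.EllipticCurves.KolyvaginDescent
open Literature.NumberTheory.GaloisRepresentations
open Literature.NumberTheory.GaloisCohomology
open Literature.NumberTheory.GaloisRepresentations.DiscreteGaloisModule (mu MuCarrier)
open Summit.BirchSwinnertonDyer.Rank1Residual.X11b
open Summit.BirchSwinnertonDyer.Rank1Residual.X11b.KolyvaginCT
open Summit.BirchSwinnertonDyer.BirchSwinnertonDyer.Theorems.ShimuraKolyvaginOrder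
-- Cup products need `LocallyCompactSpace Γ_K`, the local terms `CharZero` completions (as in the tree's files).
attribute [local instance] absoluteGaloisGroup_compactSpace charZero_placeCompletion

/-- For `Q` of infinite order and any `n`, `n ∣ [G : ℤ(n•Q)]` (index `0` read as `∞`;
`[G : ℤ nQ] = [G : ℤQ]·[ℤQ : ℤ nQ]` and `ℤQ ≅ ℤ`). [folklore] -/
private theorem dvd_index_zmultiples_nsmul {G : Type*} [AddCommGroup G] (Q : G)
    (hQ : ¬ IsOfFinAddOrder Q) (n : ℕ) : n ∣ (AddSubgroup.zmultiples (n • Q)).index := by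
  set H := AddSubgroup.zmultiples (n • Q) with hH
  have hHK : H ≤ AddSubgroup.zmultiples Q :=
    AddSubgroup.zmultiples_le_of_mem
      ((AddSubgroup.zmultiples Q).nsmul_mem (AddSubgroup.mem_zmultiples Q) n)
  have h1 : H.relIndex (AddSubgroup.zmultiples Q) ∣ H.index :=
    ⟨_, (AddSubgroup.relIndex_mul_index hHK).symm⟩
  refine dvd_trans ?_ h1
  have h2 : H.relIndex (AddSubgroup.zmultiples Q) = (H.comap (zmultiplesHom G Q)).index := by
    rw [← AddSubgroup.range_zmultiplesHom, AddMonoidHom.range_eq_map, ← AddSubgroup.relIndex_comap,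
      AddSubgroup.relIndex_top_right]
  rw [h2]
  have h3 : H.comap (zmultiplesHom G Q) = AddSubgroup.zmultiples (n : ℤ) := by
    ext k
    simp only [AddSubgroup.mem_comap, zmultiplesHom_apply, hH, AddSubgroup.mem_zmultiples_iff]
    constructor
    · rintro ⟨m, hm⟩
      refine ⟨m, ?_⟩
      have h : (m * (n : ℤ)) • Q = k • Q := by rw [mul_smul, natCast_zsmul, hm]
      have hinj := injective_zsmul_iff_not_isOfFinAddOrder.mpr hQ
      have := hinj h
      simpa [smul_eq_mul] using this
    · rintro ⟨m, rfl⟩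
      exact ⟨m, by rw [smul_eq_mul, mul_smul, natCast_zsmul]⟩
  rw [h3, Int.index_zmultiples, Int.natAbs_natCast]

/-- The levelwise Cassels–Tate inputs for THE canonical invariant maps, every number field (Milne ADT I §6):
the composition of the tree's Ш²-cochain bridge (`ShaTwoCochainTheta.casselsTate_levelInputs_of_shaTwoCochainBridge`,
re-composed here from its three route-independent parts to keep this file out of any Theses cone).
[cite: MilneADT2006, Ch. I, Thm. 4.10 (a), §6 Prop. 6.9, Thm. 6.13 (a)] -/
private theorem casselsTate_levelInputs_canonical (K : Type) [Field K] [NumberField K] :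
    casselsTate_levelInputs K :=
  ShaTwoCochainTheta.casselsTate_levelInputs_of_readout_vanishing_flip K
    (ShaTwoCochainTheta.hbridge_of_readout_criterion K
      (ShaTwoCochain.classBarInv_readout_eq_zero_of_criterion K))

variable (W : WeierstrassCurve ℚ) {K : Type} [Field K] [NumberField K]

/-- **Kolyvagin's bound REFINED by global divisibility for an ABSTRACT system of CLASSES attached to a point of finite
index** (McCallum 1991 Cor. 5.6 read as the upper bound with `m ≥ t`, Jetchev 2008 (1); Gross 1991 Prop. 2.1 ∕ §10 for
`p ∤ [E(K):ℤP]`): `Ш(E/K)[p^∞]` is finite and `ord_p #Ш(E/K)[p^∞] + 2t ≤ 2·ord_p [E(K) : ℤP]`, GRANTED the levelwise SHARP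
CLASS-level leaves `hleaves` ((A), (B), (B₂) verbatim from the tree's conductor-keyed machine, plus (D): `p^{M − t}` kills
every Kolyvagin class at level `p^M`); conductor-keyed (`N_E = N₀`); every duality input discharged by tree theorems (module
docstring). [cite: McCallumLMS1991, §1 Theorem (Kolyvagin), Lemma 5.1, Thm. 5.4, Cor. 5.6] [cite: Jetchev2008, p. 812 (1), Cor. 1.5]
[cite: GrossLMS1991, §2 Prop. 2.1, Thm. 2.2 (2), §10] [cite: MilneADT2006, Ch. I §6, Prop. 6.9, Thm. 6.13(a)] -/
theorem padicValNat_card_sha_primaryComponent_add_le_of_sharpLeaves [W.IsElliptic]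
    (hK : IsImaginaryQuadratic K) {N₀ : ℕ} [NeZero N₀] (hN : W.conductorNorm ℤ = N₀)
    {Pt : (W.baseChange K).toAffine.Point} {p : ℕ}
    (hnt : ¬ IsOfFinAddOrder Pt) (hp : p.Prime) (hp2 : p ≠ 2)
    (hρ : W.HasSurjectiveModNGaloisRep p)
    (hidx : (AddSubgroup.zmultiples Pt).index ≠ 0) (t : ℕ)
    (hleaves : ∀ {M : ℕ} (_hM : 1 ≤ M)
      (hdiv : ∀ Q : geomPoints (W.baseChange K), ∃ R, ((p ^ M : ℕ) : ℤ) • R = Q)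
      (c : K ≃ₐ[ℚ] K) (_hc : c ≠ 1),
      ∃ (ε : ℤ) (cl : ℕ → galH1Torsion (W.baseChange K) ((p ^ M : ℕ) : ℤ)),
        (ε = 1 ∨ ε = -1) ∧
        IsOfFinAddOrder (Affine.Point.map (W' := W) (c : K →ₐ[ℚ] K) Pt - ε • Pt) ∧
        cl 1 = kummerMapTorsion (W.baseChange K) _ hdiv Pt ∧
        (∀ m : ℕ, Squarefree m →
          (∀ q ∈ m.primeFactors, IsKolyvaginPrime N₀ W K p q ∧ FrobEqFrobInfty W K (p ^ M) q) →
          conjAct W c _ (cl m) = (ε * (-1) ^ m.primeFactors.card) • cl m ∧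
          (∀ v : HeightOneSpectrum (𝓞 K), (m : 𝓞 K) ∉ v.asIdeal →
            cl m ∈ selmerLocalKer (W.baseChange K) (v.adicCompletion K) ((p ^ M : ℕ) : ℤ)) ∧
          (∀ ℓ : ℕ, ℓ.Prime → ℓ ∣ m → ∀ v : HeightOneSpectrum (𝓞 K), (ℓ : 𝓞 K) ∈ v.asIdeal →
            ∀ a : ℕ, (((p : ℤ) ^ a) • cl m ∈
                selmerLocalKer (W.baseChange K) (v.adicCompletion K) ((p ^ M : ℕ) : ℤ) ↔
              ((p : ℤ) ^ a) • cl (m / ℓ) ∈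
                (W.baseChange K).torsionLocalKer (v.adicCompletion K) ((p ^ M : ℕ) : ℤ)))) ∧
        (∀ ℓ : ℕ, IsKolyvaginPrime N₀ W K p ℓ ∧ FrobEqFrobInfty W K (p ^ M) ℓ →
          ∀ ν : ℤ, (ν = 1 ∨ ν = -1) → ∀ d : galH1Torsion (W.baseChange K) ((p ^ M : ℕ) : ℤ),
          conjAct W c _ d = ν • d →
          (∀ v : HeightOneSpectrum (𝓞 K), (ℓ : 𝓞 K) ∉ v.asIdeal →
            d ∈ selmerLocalKer (W.baseChange K) (v.adicCompletion K) ((p ^ M : ℕ) : ℤ)) →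
          (∀ w : InfinitePlace K,
            d ∈ selmerLocalKer (W.baseChange K) w.Completion ((p ^ M : ℕ) : ℤ)) →
          ∀ s ∈ selmerGroup (W.baseChange K) ((p ^ M : ℕ) : ℤ), conjAct W c _ s = ν • s →
          ∀ a : ℕ, a < M → ∀ v : HeightOneSpectrum (𝓞 K), (ℓ : 𝓞 K) ∈ v.asIdeal →
            ((p : ℤ) ^ a) • d ∉
              selmerLocalKer (W.baseChange K) (v.adicCompletion K) ((p ^ M : ℕ) : ℤ) →
            ((p : ℤ) ^ (M - 1 - a)) • s ∈
              (W.baseChange K).torsionLocalKer (v.adicCompletion K) ((p ^ M : ℕ) : ℤ)) ∧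
        (∀ ℓ ℓ' : ℕ, IsKolyvaginPrime N₀ W K p ℓ ∧ FrobEqFrobInfty W K (p ^ M) ℓ →
          IsKolyvaginPrime N₀ W K p ℓ' ∧ FrobEqFrobInfty W K (p ^ M) ℓ' → ℓ ≠ ℓ' →
          ∀ ν : ℤ, (ν = 1 ∨ ν = -1) → ∀ d : galH1Torsion (W.baseChange K) ((p ^ M : ℕ) : ℤ),
          conjAct W c _ d = ν • d →
          (∀ v : HeightOneSpectrum (𝓞 K), (ℓ : 𝓞 K) ∉ v.asIdeal → (ℓ' : 𝓞 K) ∉ v.asIdeal →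
            d ∈ selmerLocalKer (W.baseChange K) (v.adicCompletion K) ((p ^ M : ℕ) : ℤ)) →
          (∀ w : InfinitePlace K,
            d ∈ selmerLocalKer (W.baseChange K) w.Completion ((p ^ M : ℕ) : ℤ)) →
          ∀ s ∈ selmerGroup (W.baseChange K) ((p ^ M : ℕ) : ℤ), conjAct W c _ s = ν • s →
          (∀ v : HeightOneSpectrum (𝓞 K), (ℓ' : 𝓞 K) ∈ v.asIdeal →
            s ∈ (W.baseChange K).torsionLocalKer (v.adicCompletion K) ((p ^ M : ℕ) : ℤ)) →
          ∀ a : ℕ, a < M → ∀ v : HeightOneSpectrum (𝓞 K), (ℓ : 𝓞 K) ∈ v.asIdeal →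
            ((p : ℤ) ^ a) • d ∉
              selmerLocalKer (W.baseChange K) (v.adicCompletion K) ((p ^ M : ℕ) : ℤ) →
            ((p : ℤ) ^ (M - 1 - a)) • s ∈
              (W.baseChange K).torsionLocalKer (v.adicCompletion K) ((p ^ M : ℕ) : ℤ)) ∧
        (∀ m : ℕ, Squarefree m →
          (∀ q ∈ m.primeFactors, IsKolyvaginPrime N₀ W K p q ∧ FrobEqFrobInfty W K (p ^ M) q) →
          ((p : ℤ) ^ (M - t)) • cl m = 0)) :
    Finite (AddCommGroup.primaryComponent (W.baseChange K).sha p) ∧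
    padicValNat p (Nat.card (AddCommGroup.primaryComponent (W.baseChange K).sha p)) + 2 * t ≤
      2 * padicValNat p (AddSubgroup.zmultiples Pt).index := by
  haveI : Fact p.Prime := ⟨hp⟩
  haveI : (W.baseChange K).IsElliptic := inferInstanceAs (W.map (algebraMap ℚ K)).IsElliptic
  haveI : Module.Finite ℤ (W.baseChange K).toAffine.Point :=
    (W.baseChange K).module_finite_point_holds
  obtain ⟨c, hc, hcc⟩ := exists_conj_of_isImaginaryQuadratic K hK
  have hE : ¬ W.HasCM := fun hCM => W.not_hasSurjectiveModNGaloisRep_of_hasCM hCM hp hp2 hρ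
  -- `M₀ = ord_p P` and `x₀` with `P = p^{M₀} x₀ ∉ p^{M₀+1} E(K)` (McCallum Lemma 5.1)
  obtain ⟨M₀, x₀, hx₀, hmax⟩ :=
    exists_pow_smul_eq_and_forall_ne (A := (W.baseChange K).toAffine.Point) hnt hp.two_le
  -- `p^{M₀} ∣ [E(K) : ℤP]`, so `M₀ ≤ ord_p [E(K) : ℤP]`
  have hx₀nt : ¬ IsOfFinAddOrder x₀ := fun h => hnt (hx₀ ▸ h.nsmul)
  have hM₀le : M₀ ≤ padicValNat p (AddSubgroup.zmultiples Pt).index := by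
    have hdvd : p ^ M₀ ∣ (AddSubgroup.zmultiples Pt).index := by
      rw [← hx₀]
      exact dvd_index_zmultiples_nsmul x₀ hx₀nt (p ^ M₀)
    exact (padicValNat_dvd_iff_le hidx).mp hdvd
  rcases Nat.eq_zero_or_pos M₀ with hM0 | hMpos
  · /- `p ∤ P`: Gross's §10 descent from the per-prime local data at level `p` gives
       `Sel(E/K)_p = ℤ δP`, hence `Ш(E/K)[p] = 0` and `Ш(E/K)[p^∞] = 0`. -/
    subst hM0
    have hndiv : ¬ ∃ Q : (W.baseChange K).toAffine.Point, p • Q = Pt := by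
      rintro ⟨Q, hQ⟩
      exact hmax Q (by simpa using hQ)
    have hp0 : ((p : ℕ) : ℤ) ≠ 0 := by exact_mod_cast hp.ne_zero
    let hdiv₀ : ∀ Q : geomPoints (W.baseChange K), ∃ R, ((p : ℕ) : ℤ) • R = Q :=
      (W.baseChange K).zsmul_geomPoints_surjective_of_charZero hp0
    -- the leaves at level `p = p^1`, read through a level-generic restatement (by `Iff.rfl`)
    obtain ⟨Φ, hΦ⟩ : ∃ Φ : ℕ → ℕ → Prop, ∀ M n : ℕ, (Φ M n ↔ ∀
          (hdiv : ∀ Q : geomPoints (W.baseChange K), ∃ R, ((n : ℕ) : ℤ) • R = Q)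
          (c : K ≃ₐ[ℚ] K) (_hc : c ≠ 1),
          ∃ (ε : ℤ) (cl : ℕ → galH1Torsion (W.baseChange K) ((n : ℕ) : ℤ)),
            (ε = 1 ∨ ε = -1) ∧
            IsOfFinAddOrder (Affine.Point.map (W' := W) (c : K →ₐ[ℚ] K) Pt - ε • Pt) ∧
            cl 1 = kummerMapTorsion (W.baseChange K) _ hdiv Pt ∧
            (∀ m : ℕ, Squarefree m →
              (∀ q ∈ m.primeFactors, IsKolyvaginPrime N₀ W K p q ∧ FrobEqFrobInfty W K n q) →
              conjAct W c _ (cl m) = (ε * (-1) ^ m.primeFactors.card) • cl m ∧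
              (∀ v : HeightOneSpectrum (𝓞 K), (m : 𝓞 K) ∉ v.asIdeal →
                cl m ∈ selmerLocalKer (W.baseChange K) (v.adicCompletion K) ((n : ℕ) : ℤ)) ∧
              (∀ ℓ : ℕ, ℓ.Prime → ℓ ∣ m → ∀ v : HeightOneSpectrum (𝓞 K), (ℓ : 𝓞 K) ∈ v.asIdeal →
                ∀ a : ℕ, (((p : ℤ) ^ a) • cl m ∈
                    selmerLocalKer (W.baseChange K) (v.adicCompletion K) ((n : ℕ) : ℤ) ↔
                  ((p : ℤ) ^ a) • cl (m / ℓ) ∈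
                    (W.baseChange K).torsionLocalKer (v.adicCompletion K) ((n : ℕ) : ℤ)))) ∧
            (∀ ℓ : ℕ, IsKolyvaginPrime N₀ W K p ℓ ∧ FrobEqFrobInfty W K n ℓ →
              ∀ ν : ℤ, (ν = 1 ∨ ν = -1) → ∀ d : galH1Torsion (W.baseChange K) ((n : ℕ) : ℤ),
              conjAct W c _ d = ν • d →
              (∀ v : HeightOneSpectrum (𝓞 K), (ℓ : 𝓞 K) ∉ v.asIdeal →
                d ∈ selmerLocalKer (W.baseChange K) (v.adicCompletion K) ((n : ℕ) : ℤ)) →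
              (∀ w : InfinitePlace K,
                d ∈ selmerLocalKer (W.baseChange K) w.Completion ((n : ℕ) : ℤ)) →
              ∀ s ∈ selmerGroup (W.baseChange K) ((n : ℕ) : ℤ), conjAct W c _ s = ν • s →
              ∀ a : ℕ, a < M → ∀ v : HeightOneSpectrum (𝓞 K), (ℓ : 𝓞 K) ∈ v.asIdeal →
                ((p : ℤ) ^ a) • d ∉
                  selmerLocalKer (W.baseChange K) (v.adicCompletion K) ((n : ℕ) : ℤ) →
                ((p : ℤ) ^ (M - 1 - a)) • s ∈
                  (W.baseChange K).torsionLocalKer (v.adicCompletion K) ((n : ℕ) : ℤ)) ∧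
            (∀ ℓ ℓ' : ℕ, IsKolyvaginPrime N₀ W K p ℓ ∧ FrobEqFrobInfty W K n ℓ →
              IsKolyvaginPrime N₀ W K p ℓ' ∧ FrobEqFrobInfty W K n ℓ' → ℓ ≠ ℓ' →
              ∀ ν : ℤ, (ν = 1 ∨ ν = -1) → ∀ d : galH1Torsion (W.baseChange K) ((n : ℕ) : ℤ),
              conjAct W c _ d = ν • d →
              (∀ v : HeightOneSpectrum (𝓞 K), (ℓ : 𝓞 K) ∉ v.asIdeal → (ℓ' : 𝓞 K) ∉ v.asIdeal →
                d ∈ selmerLocalKer (W.baseChange K) (v.adicCompletion K) ((n : ℕ) : ℤ)) →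
              (∀ w : InfinitePlace K,
                d ∈ selmerLocalKer (W.baseChange K) w.Completion ((n : ℕ) : ℤ)) →
              ∀ s ∈ selmerGroup (W.baseChange K) ((n : ℕ) : ℤ), conjAct W c _ s = ν • s →
              (∀ v : HeightOneSpectrum (𝓞 K), (ℓ' : 𝓞 K) ∈ v.asIdeal →
                s ∈ (W.baseChange K).torsionLocalKer (v.adicCompletion K) ((n : ℕ) : ℤ)) →
              ∀ a : ℕ, a < M → ∀ v : HeightOneSpectrum (𝓞 K), (ℓ : 𝓞 K) ∈ v.asIdeal →
                ((p : ℤ) ^ a) • d ∉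
                  selmerLocalKer (W.baseChange K) (v.adicCompletion K) ((n : ℕ) : ℤ) →
                ((p : ℤ) ^ (M - 1 - a)) • s ∈
                  (W.baseChange K).torsionLocalKer (v.adicCompletion K) ((n : ℕ) : ℤ)) ∧
            (∀ m : ℕ, Squarefree m →
              (∀ q ∈ m.primeFactors, IsKolyvaginPrime N₀ W K p q ∧ FrobEqFrobInfty W K n q) →
              ((p : ℤ) ^ (M - t)) • cl m = 0)) :=
      ⟨fun M n => _, fun M n => Iff.rfl⟩
    have hL1 : Φ 1 (p ^ 1) := (hΦ 1 (p ^ 1)).mpr (fun hdiv c' hc' => hleaves le_rfl hdiv c' hc')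
    rw [pow_one] at hL1
    obtain ⟨ε, cl, hε, -, hc1, hA, hB, -, hD⟩ := (hΦ 1 p).mp hL1 hdiv₀ c hc
    -- (D) at `M = 1`, `m = 1`: `p^{1−t} δ_p P = 0`; since `δ_p P ≠ 0` (`p ∤ P`), `t = 0`
    have ht0 : t = 0 := by
      by_contra ht
      have h1 : ((p : ℤ) ^ (1 - t)) • cl 1 = 0 :=
        hD 1 squarefree_one (fun q hq ↦ by simp [Nat.primeFactors_one] at hq)
      rw [show 1 - t = 0 by omega, pow_zero, one_smul, hc1] at h1
      have hker : Pt ∈ (kummerMapTorsion (W.baseChange K) _ hdiv₀).ker := by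
        rw [AddMonoidHom.mem_ker, h1]
      rw [kummerMapTorsion_ker, AddMonoidHom.mem_range] at hker
      obtain ⟨z, hz⟩ := hker
      exact hndiv ⟨z, by rw [← natCast_zsmul]; exact hz⟩
    subst ht0
    have hinfty : ∀ (w : InfinitePlace K) (d : galH1Torsion (W.baseChange K) ((p : ℕ) : ℤ)),
        d ∈ selmerLocalKer (W.baseChange K) w.Completion ((p : ℕ) : ℤ) := by
      intro w d
      haveI : IsAlgClosed w.Completion :=
        isAlgClosed_of_ringEquiv (InfinitePlace.Completion.ringEquivComplexOfIsComplex
          (hK.2.isComplex w)).symm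
      rw [WeierstrassCurve.selmerLocalKer_eq_top_of_isAlgClosed]
      trivial
    have hSel := (card_selmerGroup_eq_of_localData (N := N₀) (W := W) hK hp hp2 hndiv c
      ⟨ε, cl, hε, hc1, fun n hn hq => by
        have hq' : ∀ q ∈ n.primeFactors, IsKolyvaginPrime N₀ W K p q ∧ FrobEqFrobInfty W K p q :=
          fun q hq0 => ⟨hq q hq0, (hq q hq0).2.2.2.2.2⟩
        refine ⟨(hA n hn hq').1, (hA n hn hq').2.1, fun w => hinfty w _, fun ℓ hℓ hℓn v hv => ?_⟩
        have h := (hA n hn hq').2.2 ℓ hℓ hℓn v hv 0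
        simpa only [pow_zero, one_smul] using h⟩
      (fun {ℓ} hℓ ν hν d hd hfin _hinf v hv hdv s hs hτs => by
        have h := hB ℓ ⟨hℓ, hℓ.2.2.2.2.2⟩ ν hν d hd hfin (fun w => hinfty w _) s hs hτs 0
          Nat.one_pos v hv (by simpa only [pow_zero, one_smul] using hdv)
        simpa only [Nat.sub_self, pow_zero, one_smul] using h)
      (fun r cs hτ Nv hN hind =>
        McCallum1991_cor_3_2_eigen_holds N₀ W K hE hK hp hp2 hρ c hc r cs hτ Nv hN hind)).2
    -- `Ш(E/K)[p] = 0`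
    have hShap : ∀ a : (W.baseChange K).sha, p • a = 0 → a = 0 := by
      intro a ha
      have hmap := (W.baseChange K).map_torsionH1ToH1_selmerGroup_holds (n := ((p : ℕ) : ℤ)) hp0
      have ha' : (a : (W.baseChange K).galH1) ∈
          (W.baseChange K).sha ⊓ AddSubgroup.torsionBy (W.baseChange K).galH1 ((p : ℕ) : ℤ) := by
        refine ⟨a.2, AddSubgroup.torsionBy.nsmul_iff.mpr ?_⟩
        rw [← AddSubgroupClass.coe_nsmul, ha, ZeroMemClass.coe_zero]
      rw [← hmap, AddSubgroup.mem_map] at ha'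
      obtain ⟨s, hs, hts⟩ := ha'
      rw [hSel, AddSubgroup.mem_zmultiples_iff] at hs
      obtain ⟨k, rfl⟩ := hs
      apply Subtype.ext
      rw [← hts, map_zsmul]
      have h0 : torsionH1ToH1 (W.baseChange K) _ (kummerClassOfPoint W K hp Pt) = 0 :=
        torsionH1ToH1_kummerMapTorsion (W.baseChange K) _ _ Pt
      rw [h0, zsmul_zero, ZeroMemClass.coe_zero]
    -- hence `Ш(E/K)[p^∞] = 0`
    have hbot : ∀ a ∈ AddCommGroup.primaryComponent (W.baseChange K).sha p, a = 0 := by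
      intro a ha
      obtain ⟨k, hk⟩ := (AddCommGroup.mem_primaryComponent).mp ha
      induction k generalizing a with
      | zero => simpa using hk
      | succ k ih =>
        have h1 : p ^ k • a ∈ AddCommGroup.primaryComponent (W.baseChange K).sha p :=
          AddSubgroup.nsmul_mem _ ha _
        have h2 : p • (p ^ k • a) = 0 := by rw [smul_smul, ← pow_succ', hk]
        have h3 := hShap _ h2
        exact ih a ha h3
    have hsub : Subsingleton (AddCommGroup.primaryComponent (W.baseChange K).sha p) :=
      ⟨fun a b => Subtype.ext ((hbot a.1 a.2).trans (hbot b.1 b.2).symm)⟩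
    haveI : Finite (AddCommGroup.primaryComponent (W.baseChange K).sha p) := Finite.of_subsingleton
    refine ⟨‹_›, ?_⟩
    rw [Nat.card_of_subsingleton (0 : AddCommGroup.primaryComponent (W.baseChange K).sha p), padicValNat_one_right]
    omega
  · /- `p ∣ P`: McCallum's descent at level `M = 2M₀` for the abstract system, with the Weil
       pairing on `E[p^{2M₀}]` and the Cassels–Tate inputs of `casselsTate_levelInputs K`. -/
    haveI : NeZero (p ^ M₀) := ⟨pow_ne_zero _ hp.ne_zero⟩
    have hn0 : ((p ^ M₀ * p ^ M₀ : ℕ) : K) ≠ 0 := by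
      exact_mod_cast mul_ne_zero (pow_ne_zero _ hp.ne_zero) (pow_ne_zero _ hp.ne_zero)
    have h2le : 2 ≤ p ^ M₀ * p ^ M₀ :=
      le_trans hp.two_le (le_trans (Nat.le_self_pow (by omega) p) (Nat.le_mul_of_pos_right _
        (pos_of_gt (Nat.one_lt_pow (by omega) hp.one_lt))))
    obtain ⟨e, hμ, hadd₁, hadd₂, halt, hnondeg, hgal⟩ :=
      exists_weilPairing_holds (W.baseChange K) (p ^ M₀ * p ^ M₀) h2le hn0
    obtain ⟨inv, hPT', hH3, hperf, hB, hPτ⟩ :=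
      casselsTate_levelInputs_canonical K W p M₀ hp hp2 hMpos c hc hcc e hμ hadd₁ hadd₂ hgal halt hnondeg
    have hinv : ∀ v : HeightOneSpectrum (𝓞 K), Injective (inv (Sum.inr v)) :=
      fun v => (hperf v).1.injective
    obtain ⟨hfin, -, -, hle⟩ :=
      card_sha_primary_le_at_of_sharpLeavesM₂_of_localDuality_of_conductorNorm W hK hN hnt hp hp2 hρ
        Literature.NumberTheory.Automorphic.chebotarev_artinRep_holds (exists_weilPairing_holds W p)
        hMpos hc hcc hx₀ hmax t hleaves e hμ hadd₁ hadd₂ hgal halt hnondeg inv hPT' hinv hH3 hB hPτ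
    exact ⟨hfin, by omega⟩

end Summit.BirchSwinnertonDyer.BirchSwinnertonDyer.Theorems.GenusSharpKolyvagin

end
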